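import Summits.HubbardSuperconductivity.HubbardSuperconductivity.Theorems.AnisotropyChordKnnXYPoint21
import Summits.HubbardSuperconductivity.HubbardSuperconductivity.Theorems.AnisotropyChordKnnXYPoint25
import Summits.HubbardSuperconductivity.HubbardSuperconductivity.Theorems.AnisotropyChordKnnXYPoint29
import Summits.HubbardSuperconductivity.HubbardSuperconductivity.Theorems.AnisotropyChordKnnXYPoint32Data

/-!
# Route `AnisotropyChord` / H0 rotor rung, K_{n,n} sibling of XY-LM₀: **`XYLiebMattisKnn n 0` for every `n ≤ 32`**
# (the booked «XY-LM₀ toy-model rung 0 (K_{n,n}, s ≤ 16)», director ruling CYCLE 12 (B)) — KERNEL-CHECKED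
(prover seat `hubbard-h0-rotor-p1` g13; theory seat `hubbard-h0-rotor-theory-1` THEOREMS M12–M20)

Chain, all in Lean: M12 two-big-spin Jacobi reduction (definitional, as typed in `…KnnBlock`) + THEOREM Q (`…KnnTwoLevel`,
`…KnnTopSectors`; all `n`, all `η > 0`) + LEMMA R (`…KnnMLR`; Riccati comparison ⇒ MLR) + the budget conditions (S_M) at
`η = 1` for `4 ≤ n ≤ 32`, `0 ≤ M ≤ n − 4` from 435 exact rational certificates (`…KnnXYPoint`, `…KnnXYPoint21/25/29/32Data`,
checked by `decide +kernel` via `budgetCondition_of_checkCert`).  No `native_decide`, standard axioms.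
-/

set_option linter.dupNamespace false
set_option autoImplicit false

namespace Summit.HubbardSuperconductivity.HubbardSuperconductivity.Theorems.AnisotropyChord.Knn

/-- (S_M) at the XY point for all `4 ≤ n ≤ 32`, `M + 4 ≤ n`, from the five certificate tables. [folklore] -/
theorem budgetCondition_xy_of_le_32 {n M : ℕ} (hn : n ≤ 32) (hM : M + 4 ≤ n) :
    BudgetCondition n M ((1 : ℚ) : ℝ) := by
  by_cases h16 : n ≤ 16
  · exact budgetCondition_of_certsOK (by norm_num) xyCerts16_ok (by omega) h16 hM
  by_cases h21 : n ≤ 21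
  · exact budgetCondition_of_certsOK (by norm_num) xyCerts21_ok (by omega) h21 hM
  by_cases h25 : n ≤ 25
  · exact budgetCondition_of_certsOK (by norm_num) xyCerts25_ok (by omega) h25 hM
  by_cases h29 : n ≤ 29
  · exact budgetCondition_of_certsOK (by norm_num) xyCerts29_ok (by omega) h29 hM
  · exact budgetCondition_of_certsOK (by norm_num) xyCerts32_ok (by omega) hn hM

/-- **THEOREM OF RECORD (XY-Lieb–Mattis ordering on `K_{n,n}` at the XY point, all `n ≤ 32`, kernel-checked):** for every
`n ≤ 32`, `XYLiebMattisKnn n 0` — in the spin-½ XY ferromagnet on the complete bipartite graph `K_{n,n}` (two-big-spin Jacobi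
reduction `P_M(1)`, THEOREMS M12, definitional) the sector ground states' `⟨S⃗²⟩ = ⟨J(J+1)⟩` is non-decreasing in `|Sᶻ_tot|`
(`|M| ≤ |M'| ≤ n ⇒ g(M) ≤ g(M')`).  This is the booked «XY-LM₀ toy-model rung 0 (K_{n,n}, s ≤ 16): decided instance family of
a new conjecture» (director ruling CYCLE 12 (B)), now a Lean theorem: THEOREM Q + LEMMA R + 435 certified budget conditions.
It is NOT a statement about tori `(ℤ/L)²` (XY-LM₀ = `Tower.TotalSpinMonotone 0` stays OPEN) nor about the Hubbard model.
[conjecture: theory seat hubbard-h0-rotor-theory-1, cycle 12 — decided instance family (M17/M20); Lean proof here] -/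
theorem xyLiebMattisKnn_zero_of_le_32 {n : ℕ} (hn : n ≤ 32) : XYLiebMattisKnn n 0 := by
  apply xyLiebMattisKnn_of_budgets (by norm_num)
  intro M hM
  have hb := budgetCondition_xy_of_le_32 hn hM
  rw [Rat.cast_one] at hb
  rw [sub_zero]
  exact hb

end Summit.HubbardSuperconductivity.HubbardSuperconductivity.Theorems.AnisotropyChord.Knn
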